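import Summits.CriticalPhenomena.CardyFormulaZ2.Theorems.CardyIKTransportIKLinearTransportStubPinnedSamplerCFTPCore

/-!
# Stub `stub_PinnedSampler` — coupling from the past along rows, part 4: EXACTNESS OF SWEEPS from the
# exactness of ONE row resampling

Theorem-only support file (`--supports stmt-CriticalPhenomena-5076`, registered sub-goal
`ps2_exact_sweep_of_exact_row`). The Propp–Wilson law (`ps2_cftp_jointLaw`) and the pinned sampler
(`ps2_pinnedSampler_of_rowCFTP`) consume MULTI-ROW exactness: every sweep of the middle rows
`a, …, a+n-1` from `X' ∼ νmix (S ∆ {i,i+1})`, each row resampled with its own fresh bits, has — jointly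
with the pinned statistic, on the events not reading the middle rows `≥ a+n` — the law of `X'` again.
This file derives it from the natural ONE-ROW hypotheses on the row dynamics `Φ y p u z`: it reads the
fresh bits `u` only at the cells of row `y`, its new middle row `y` depends on the start `z` only through
the rows below `y`, and ONE resampling of row `y` from `X'` is exact. The proof is the chain rule: the bits
of distinct rows are independent under `β` (merging the row-`y` bits of an independent copy preserves `β`,
by uniqueness of the product Bernoulli measure on boxes), Tonelli, and the induction hypothesis applied to
the row-`y` resampling probability seen as a function of the configuration below row `y`.
-/

noncomputable section

namespace Summit.CriticalPhenomena.CardyFormulaZ2.Theorems.IKLinearTransport.PinnedDiagramExchange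

open scoped Classical MeasureTheory ENNReal ProbabilityTheory symmDiff Topology
open Set MeasureTheory Filter
open Literature.Probability.Percolation Literature.Probability.LatticeModels

/-! ## Independence of the rows of fresh bits: merging a row from an independent copy -/

/-- MERGING the row-`y` bits of an independent copy of the fresh randomness preserves `β`. [folklore] -/
theorem ps2_beta_merge_row (y : ℤ) :
    (β.prod β).map (fun uv : Rnd × Rnd => {q : Site 2 × ℕ | if q.1 1 = y then q ∈ uv.2 else q ∈ uv.1}) = β := by
  haveI : IsProbabilityMeasure β := by
    rw [show β = sitePercolation (Site 2 × ℕ) half from rfl]; infer_instance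
  set V := Site 2 × ℕ
  set so : (V → Prop) → Set V := fun χ => {v | χ v} with hso
  have hsom : Measurable so := measurable_setOf
  set mg : Rnd × Rnd → Rnd := fun uv => {q : V | if q.1 1 = y then q ∈ uv.2 else q ∈ uv.1} with hmg
  set mg' : (V → Prop) × (V → Prop) → (V → Prop) := fun cp q => if q.1 1 = y then cp.2 q else cp.1 q
    with hmg'
  have hmgm' : Measurable mg' := by
    refine measurable_pi_lambda _ fun q => ?_
    by_cases h : q.1 1 = y
    · have e : (fun cp : (V → Prop) × (V → Prop) => mg' cp q) = fun cp => cp.2 q := by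
        funext cp; show (if q.1 1 = y then cp.2 q else cp.1 q) = cp.2 q; rw [if_pos h]
      rw [e]; exact (measurable_pi_apply q).comp measurable_snd
    · have e : (fun cp : (V → Prop) × (V → Prop) => mg' cp q) = fun cp => cp.1 q := by
        funext cp; show (if q.1 1 = y then cp.2 q else cp.1 q) = cp.1 q; rw [if_neg h]
      rw [e]; exact (measurable_pi_apply q).comp measurable_fst
  have hβ : β = (sitePi V half).map so := sitePercolation_eq_map half
  -- the merge on `V → Prop` preserves the product Bernoulli measure
  have hkey : ((sitePi V half).prod (sitePi V half)).map mg' = sitePi V half := by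
    unfold sitePi
    refine Measure.eq_infinitePi _ fun s t ht => ?_
    rw [Measure.map_apply hmgm' (MeasurableSet.pi s.countable_toSet fun q _ => ht q)]
    have hpre : mg' ⁻¹' Set.pi (↑s) t =
        Set.pi (↑(s.filter fun q => ¬ q.1 1 = y)) t ×ˢ Set.pi (↑(s.filter fun q => q.1 1 = y)) t := by
      ext cp
      simp only [mem_preimage, Set.mem_pi, Finset.mem_coe, mem_prod, Finset.mem_filter, hmg']
      constructor
      · intro h
        refine ⟨fun q hq => ?_, fun q hq => ?_⟩
        · have := h q hq.1; rwa [if_neg hq.2] at this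
        · have := h q hq.1; rwa [if_pos hq.2] at this
      · rintro ⟨h1, h2⟩ q hq
        by_cases hc : q.1 1 = y
        · rw [if_pos hc]; exact h2 q ⟨hq, hc⟩
        · rw [if_neg hc]; exact h1 q ⟨hq, hc⟩
    rw [hpre, Measure.prod_prod, Measure.infinitePi_pi _ (fun q _ => ht q),
      Measure.infinitePi_pi _ (fun q _ => ht q), mul_comm,
      Finset.prod_filter_mul_prod_filter_not]
  -- transport along `setOf`
  have hcomm : mg ∘ Prod.map so so = so ∘ mg' := by
    funext cp; ext q
    show (if q.1 1 = y then q ∈ {v | cp.2 v} else q ∈ {v | cp.1 v}) ↔ (if q.1 1 = y then cp.2 q else cp.1 q)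
    exact Iff.rfl
  have hmgm : Measurable mg := by
    refine measurable_set_iff.2 fun q => ?_
    by_cases h : q.1 1 = y
    · have e : (fun uv : Rnd × Rnd => q ∈ mg uv) = fun uv => q ∈ uv.2 := by
        funext uv; show (if q.1 1 = y then q ∈ uv.2 else q ∈ uv.1) = (q ∈ uv.2); rw [if_pos h]
      rw [e]; exact (measurable_set_mem q).comp measurable_snd
    · have e : (fun uv : Rnd × Rnd => q ∈ mg uv) = fun uv => q ∈ uv.1 := by
        funext uv; show (if q.1 1 = y then q ∈ uv.2 else q ∈ uv.1) = (q ∈ uv.1); rw [if_neg h]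
      rw [e]; exact (measurable_set_mem q).comp measurable_fst
  rw [hβ, Measure.map_prod_map _ _ hsom hsom, Measure.map_map hmgm (hsom.prodMap hsom), hcomm,
    ← Measure.map_map hsom hmgm', hkey]

/-! ## Sweeps read only the bits of the rows they visit -/

section Exact

variable {S : Set ℤ} {i : ℤ} {Φ : ℤ → Obs × Set (Site 2 × Site 2) → Rnd → Obs → Obs}
  {T : ℕ → ℤ → Obs × Set (Site 2 × Site 2) → Rnd → Obs → Obs}

/-- A sweep of the rows `a … a+n-1` reads the fresh bits of these rows only. [folklore] -/
theorem ps2_sweep_bits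
    (hT : ∀ n a p u z, T n a p u z = ((fun q : ℤ × Obs => (q.1 + 1, Φ q.1 p u q.2))^[n] (a, z)).2)
    (hRd : ∀ (y : ℤ) (p : Obs × Set (Site 2 × Site 2)) (z : Obs) (u u' : Rnd),
      (∀ (w : Site 2) (k : ℕ), w 1 = y → ((w, k) ∈ u ↔ (w, k) ∈ u')) → Φ y p u z = Φ y p u' z)
    (n : ℕ) (a : ℤ) (p : Obs × Set (Site 2 × Site 2)) (z : Obs) (u u' : Rnd)
    (h : ∀ (w : Site 2) (k : ℕ), a ≤ w 1 → w 1 < a + n → ((w, k) ∈ u ↔ (w, k) ∈ u')) :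
    T n a p u z = T n a p u' z := by
  induction n with
  | zero => rw [ps2_sweep_zero hT, ps2_sweep_zero hT]
  | succ n ih =>
    rw [ps2_sweep_succ hT, ps2_sweep_succ hT, ih fun w k h1 h2 => h w k h1 (by push_cast; omega)]
    exact hRd _ _ _ _ _ fun w k hw => h w k (by omega) (by push_cast; omega)

/-! ## The chain rule: exact row resampling ⇒ exact sweeps -/

/-- EXACT SWEEPS FROM EXACT ROWS (registered sub-goal `ps2_exact_sweep_of_exact_row`). If the row
dynamics reads the bits of its own row only, its new middle row depends on the start only below that row,
and ONE resampling of a middle row from `X' ∼ νmix (S ∆ {i,i+1})` is exact — jointly with the pinned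
statistic, on the events reading only the rows up to it and the off-middle data — then every sweep of the
rows `a, …, a+n-1` is exact on the events reading only the rows `< a+n` and the off-middle data; in
particular (second conclusion) in the form the Propp–Wilson law `ps2_cftp_jointLaw` consumes. [folklore] -/
theorem ps2_exact_sweep_of_exact_row :
    ∀ (S : Set ℤ) (i : ℤ) (Φ : ℤ → Obs × Set (Site 2 × Site 2) → Rnd → Obs → Obs)
      (T : ℕ → ℤ → Obs × Set (Site 2 × Site 2) → Rnd → Obs → Obs),
      (∀ n a p u z, T n a p u z = ((fun q : ℤ × Obs => (q.1 + 1, Φ q.1 p u q.2))^[n] (a, z)).2) →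
      (∀ y, Measurable fun t : (Obs × Set (Site 2 × Site 2)) × (Rnd × Obs) => Φ y t.1 t.2.1 t.2.2) →
      (∀ y p u z, (∀ w : Site 2, w ≠ ![i + 1, y] → (w ∈ (Φ y p u z).1 ↔ w ∈ z.1)) ∧
        (∀ f : Site 2, f ≠ ![i, y] → f ≠ ![i + 1, y] → (f ∈ (Φ y p u z).2 ↔ f ∈ z.2))) →
      (∀ (y : ℤ) (p : Obs × Set (Site 2 × Site 2)) (z : Obs) (u u' : Rnd),
        (∀ (w : Site 2) (k : ℕ), w 1 = y → ((w, k) ∈ u ↔ (w, k) ∈ u')) → Φ y p u z = Φ y p u' z) →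
      (∀ (y : ℤ) (p : Obs × Set (Site 2 × Site 2)) (u : Rnd) (z z' : Obs),
        (∀ w : Site 2, w 1 < y → (w ∈ z.1 ↔ w ∈ z'.1) ∧ (w ∈ z.2 ↔ w ∈ z'.2)) →
        (![i + 1, y] ∈ (Φ y p u z).1 ↔ ![i + 1, y] ∈ (Φ y p u z').1) ∧
        (![i, y] ∈ (Φ y p u z).2 ↔ ![i, y] ∈ (Φ y p u z').2) ∧
        (![i + 1, y] ∈ (Φ y p u z).2 ↔ ![i + 1, y] ∈ (Φ y p u z').2)) →
      (∀ (y : ℤ) (D : Set ((Obs × Set (Site 2 × Site 2)) × Obs)), MeasurableSet D →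
        (∀ (p : Obs × Set (Site 2 × Site 2)) (z z' : Obs),
          ((∀ w : Site 2, (w 1 < y + 1 ∨ w 0 ≠ i + 1) → (w ∈ z.1 ↔ w ∈ z'.1)) ∧
           (∀ w : Site 2, (w 1 < y + 1 ∨ (w 0 ≠ i ∧ w 0 ≠ i + 1)) → (w ∈ z.2 ↔ w ∈ z'.2))) →
          ((p, z) ∈ D ↔ (p, z') ∈ D)) →
        ((νmix (symmDiff S {i, i + 1})).prod β) {xu | ((eraseMid i xu.1, stripDiagram i xu.1),
          Φ y (eraseMid i xu.1, stripDiagram i xu.1) xu.2 xu.1) ∈ D} =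
        (νmix (symmDiff S {i, i + 1})) {x | ((eraseMid i x, stripDiagram i x), x) ∈ D}) →
      (∀ (n : ℕ) (a : ℤ) (D : Set ((Obs × Set (Site 2 × Site 2)) × Obs)), MeasurableSet D →
        (∀ (p : Obs × Set (Site 2 × Site 2)) (z z' : Obs),
          ((∀ w : Site 2, (w 1 < a + n ∨ w 0 ≠ i + 1) → (w ∈ z.1 ↔ w ∈ z'.1)) ∧
           (∀ w : Site 2, (w 1 < a + n ∨ (w 0 ≠ i ∧ w 0 ≠ i + 1)) → (w ∈ z.2 ↔ w ∈ z'.2))) →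
          ((p, z) ∈ D ↔ (p, z') ∈ D)) →
        ((νmix (symmDiff S {i, i + 1})).prod β) {xu | ((eraseMid i xu.1, stripDiagram i xu.1),
          T n a (eraseMid i xu.1, stripDiagram i xu.1) xu.2 xu.1) ∈ D} =
        (νmix (symmDiff S {i, i + 1})) {x | ((eraseMid i x, stripDiagram i x), x) ∈ D}) ∧
      (∀ (n : ℕ) (a : ℤ) (D : Set ((Obs × Set (Site 2 × Site 2)) × Obs)), MeasurableSet D →
        (∀ (p : Obs × Set (Site 2 × Site 2)) (z z' : Obs), (∀ w : Site 2, w 1 < a + n →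
          (w ∈ z.1 ↔ w ∈ z'.1) ∧ (w ∈ z.2 ↔ w ∈ z'.2)) → ((p, z) ∈ D ↔ (p, z') ∈ D)) →
        ((νmix (symmDiff S {i, i + 1})).prod β) {xu | ((eraseMid i xu.1, stripDiagram i xu.1),
          T n a (eraseMid i xu.1, stripDiagram i xu.1) xu.2 xu.1) ∈ D} =
        (νmix (symmDiff S {i, i + 1})) {x | ((eraseMid i x, stripDiagram i x), x) ∈ D}) := by
  intro S i Φ T hT hΦm hW hRd hPast hEx
  set ν' := νmix (symmDiff S {i, i + 1}) with hν'
  haveI : IsProbabilityMeasure ν' := isProbabilityMeasure_nuMix _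
  haveI : IsProbabilityMeasure β := by
    rw [show β = sitePercolation (Site 2 × ℕ) half from rfl]; infer_instance
  set P' := ν'.prod β with hP'
  set π : Obs → Obs × Set (Site 2 × Site 2) := fun x => (eraseMid i x, stripDiagram i x) with hπdef
  have hπ : Measurable π := (measurable_eraseMid i).prodMk (ps_measurable_stripDiagram i)
  -- the strong statement, by induction on the number of rows
  have main : ∀ (n : ℕ) (a : ℤ) (D : Set ((Obs × Set (Site 2 × Site 2)) × Obs)), MeasurableSet D →
      (∀ (p : Obs × Set (Site 2 × Site 2)) (z z' : Obs),
        ((∀ w : Site 2, (w 1 < a + n ∨ w 0 ≠ i + 1) → (w ∈ z.1 ↔ w ∈ z'.1)) ∧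
         (∀ w : Site 2, (w 1 < a + n ∨ (w 0 ≠ i ∧ w 0 ≠ i + 1)) → (w ∈ z.2 ↔ w ∈ z'.2))) →
        ((p, z) ∈ D ↔ (p, z') ∈ D)) →
      P' {xu | (π xu.1, T n a (π xu.1) xu.2 xu.1) ∈ D} = ν' {x | (π x, x) ∈ D} := by
    intro n
    induction n with
    | zero =>
      intro a D hDm _
      have hJ : Measurable fun x : Obs => (π x, x) := hπ.prodMk measurable_id
      have hset : {xu : Obs × Rnd | (π xu.1, T 0 a (π xu.1) xu.2 xu.1) ∈ D} =
          {x : Obs | (π x, x) ∈ D} ×ˢ (univ : Set Rnd) := by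
        ext xu; simp [ps2_sweep_zero hT]
      rw [hset, hP', Measure.prod_prod, measure_univ, mul_one]
    | succ n ih =>
      intro a D hDm hD
      set y : ℤ := a + n with hy
      -- the sweep of `n` rows and the merge of the row-`y` bits
      set Y : Obs × Rnd → Obs := fun xu => T n a (π xu.1) xu.2 xu.1 with hYdef
      have hY : Measurable Y := (ps2_sweep_measurable hT hΦm n a).comp
        ((hπ.comp measurable_fst).prodMk (measurable_snd.prodMk measurable_fst))
      have hsucc : ∀ xu : Obs × Rnd, T (n + 1) a (π xu.1) xu.2 xu.1 = Φ y (π xu.1) xu.2 (Y xu) :=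
        fun xu => ps2_sweep_succ hT n a _ _ _
      -- `K (p, z) = β {v | (p, Φ y p v z) ∈ D}`
      set E : Set (((Obs × Set (Site 2 × Site 2)) × Obs) × Rnd) :=
        {t | (t.1.1, Φ y t.1.1 t.2 t.1.2) ∈ D} with hE
      have hEm : MeasurableSet E := by
        have : Measurable fun t : ((Obs × Set (Site 2 × Site 2)) × Obs) × Rnd =>
            (t.1.1, Φ y t.1.1 t.2 t.1.2) :=
          (measurable_fst.comp measurable_fst).prodMk ((hΦm y).comp
            ((measurable_fst.comp measurable_fst).prodMk (measurable_snd.prodMk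
              (measurable_snd.comp measurable_fst))))
        exact this hDm
      set K : (Obs × Set (Site 2 × Site 2)) × Obs → ℝ≥0∞ := fun q => β (Prod.mk q ⁻¹' E) with hK
      have hKm : Measurable K := measurable_measure_prodMk_left hEm
      have hKapply : ∀ (p : Obs × Set (Site 2 × Site 2)) (z : Obs),
          K (p, z) = β {v | (p, Φ y p v z) ∈ D} := fun p z => rfl
      -- (1) the law of the `(n+1)`-sweep through `K`
      have hset : MeasurableSet {xu : Obs × Rnd | (π xu.1, Φ y (π xu.1) xu.2 (Y xu)) ∈ D} := by
        have : Measurable fun xu : Obs × Rnd => (π xu.1, Φ y (π xu.1) xu.2 (Y xu)) :=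
          (hπ.comp measurable_fst).prodMk ((hΦm y).comp ((hπ.comp measurable_fst).prodMk
            (measurable_snd.prodMk hY)))
        exact this hDm
      have h1 : P' {xu | (π xu.1, T (n + 1) a (π xu.1) xu.2 xu.1) ∈ D} =
          ∫⁻ x, ∫⁻ u, K (π x, Y (x, u)) ∂β ∂ν' := by
        simp_rw [hsucc]
        rw [hP', Measure.prod_apply hset]
        refine lintegral_congr fun x => ?_
        -- merge an independent copy of the row-`y` bits
        have hpre : MeasurableSet (Prod.mk x ⁻¹' {xu : Obs × Rnd | (π xu.1, Φ y (π xu.1) xu.2 (Y xu)) ∈ D}) :=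
          measurable_prodMk_left hset
        conv_lhs => rw [← ps2_beta_merge_row y]
        rw [Measure.map_apply ?_ hpre]
        swap
        · refine measurable_set_iff.2 fun q => ?_
          by_cases h : q.1 1 = y
          · have e : (fun uv : Rnd × Rnd => q ∈ ({q : Site 2 × ℕ | if q.1 1 = y then q ∈ uv.2 else q ∈ uv.1} :
                Set (Site 2 × ℕ))) = fun uv => q ∈ uv.2 := by
              funext uv; show (if q.1 1 = y then q ∈ uv.2 else q ∈ uv.1) = (q ∈ uv.2); rw [if_pos h]
            rw [e]; exact (measurable_set_mem q).comp measurable_snd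
          · have e : (fun uv : Rnd × Rnd => q ∈ ({q : Site 2 × ℕ | if q.1 1 = y then q ∈ uv.2 else q ∈ uv.1} :
                Set (Site 2 × ℕ))) = fun uv => q ∈ uv.1 := by
              funext uv; show (if q.1 1 = y then q ∈ uv.2 else q ∈ uv.1) = (q ∈ uv.1); rw [if_neg h]
            rw [e]; exact (measurable_set_mem q).comp measurable_fst
        have hident : (fun uv : Rnd × Rnd => {q : Site 2 × ℕ | if q.1 1 = y then q ∈ uv.2 else q ∈ uv.1}) ⁻¹'
            (Prod.mk x ⁻¹' {xu : Obs × Rnd | (π xu.1, Φ y (π xu.1) xu.2 (Y xu)) ∈ D}) =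
            {uv : Rnd × Rnd | (π x, Φ y (π x) uv.2 (Y (x, uv.1))) ∈ D} := by
          ext uv
          simp only [mem_preimage, mem_setOf_eq]
          have hrow : Φ y (π x) {q : Site 2 × ℕ | if q.1 1 = y then q ∈ uv.2 else q ∈ uv.1} (Y (x, uv.1)) =
              Φ y (π x) uv.2 (Y (x, uv.1)) :=
            hRd y (π x) _ _ _ fun w k hw => by simp only [mem_setOf_eq, hw, if_true]
          have hlow : Y (x, {q : Site 2 × ℕ | if q.1 1 = y then q ∈ uv.2 else q ∈ uv.1}) = Y (x, uv.1) := by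
            simp only [hYdef]
            refine ps2_sweep_bits hT hRd n a (π x) x _ _ fun w k h1 h2 => ?_
            have hne : ¬ w 1 = y := by rw [hy]; omega
            simp only [mem_setOf_eq, hne, if_false]
          rw [hlow, hrow]
        rw [hident]
        have hset2 : MeasurableSet {uv : Rnd × Rnd | (π x, Φ y (π x) uv.2 (Y (x, uv.1))) ∈ D} := by
          have : Measurable fun uv : Rnd × Rnd => (π x, Φ y (π x) uv.2 (Y (x, uv.1))) :=
            measurable_const.prodMk ((hΦm y).comp (measurable_const.prodMk (measurable_snd.prodMk
              (hY.comp (measurable_const.prodMk measurable_fst)))))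
          exact this hDm
        rw [Measure.prod_apply hset2]
        rfl
      -- (2) the one-row resampling of `X'` through `K`
      have hset3 : MeasurableSet {xu : Obs × Rnd | (π xu.1, Φ y (π xu.1) xu.2 xu.1) ∈ D} := by
        have : Measurable fun xu : Obs × Rnd => (π xu.1, Φ y (π xu.1) xu.2 xu.1) :=
          (hπ.comp measurable_fst).prodMk ((hΦm y).comp ((hπ.comp measurable_fst).prodMk
            (measurable_snd.prodMk measurable_fst)))
        exact this hDm
      have hDy : ∀ (p : Obs × Set (Site 2 × Site 2)) (z z' : Obs),
          ((∀ w : Site 2, (w 1 < y + 1 ∨ w 0 ≠ i + 1) → (w ∈ z.1 ↔ w ∈ z'.1)) ∧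
           (∀ w : Site 2, (w 1 < y + 1 ∨ (w 0 ≠ i ∧ w 0 ≠ i + 1)) → (w ∈ z.2 ↔ w ∈ z'.2))) →
          ((p, z) ∈ D ↔ (p, z') ∈ D) := fun p z z' h =>
        hD p z z' ⟨fun w hw => h.1 w (by rw [hy] at *; omega),
          fun w hw => h.2 w (by rw [hy] at *; omega)⟩
      have h2 : ν' {x | (π x, x) ∈ D} = ∫⁻ x, K (π x, x) ∂ν' := by
        rw [← hEx y D hDm hDy, hP', Measure.prod_apply hset3]
        rfl
      -- (3) `K` only reads the rows `< y` and the off-middle data of the configuration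
      set tr : Obs → Obs := fun z => ({w | w ∈ z.1 ∧ (w 1 < y ∨ w 0 ≠ i + 1)},
        {f | f ∈ z.2 ∧ (f 1 < y ∨ (f 0 ≠ i ∧ f 0 ≠ i + 1))}) with htr
      have htrm : Measurable tr :=
        (measurable_set_iff.2 fun w => ((measurable_set_mem w).comp measurable_fst).and measurable_const).prodMk
          (measurable_set_iff.2 fun f => ((measurable_set_mem f).comp measurable_snd).and measurable_const)
      set τ : (Obs × Set (Site 2 × Site 2)) × Obs → (Obs × Set (Site 2 × Site 2)) × Obs :=
        fun q => (q.1, tr q.2) with hτ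
      have hτm : Measurable τ := measurable_fst.prodMk (htrm.comp measurable_snd)
      have htr_agree : ∀ (z : Obs) (w' : Site 2), w' 1 < y →
          (w' ∈ (tr z).1 ↔ w' ∈ z.1) ∧ (w' ∈ (tr z).2 ↔ w' ∈ z.2) := fun z w' hw' =>
        ⟨⟨fun h => h.1, fun h => ⟨h, Or.inl hw'⟩⟩, ⟨fun h => h.1, fun h => ⟨h, Or.inl hw'⟩⟩⟩
      have hKτ : K ∘ τ = K := by
        funext q
        obtain ⟨p, z⟩ := q
        simp only [Function.comp_apply, hτ, hKapply]
        congr 1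
        ext v
        simp only [mem_setOf_eq]
        refine hDy p _ _ ⟨fun w hw => ?_, fun w hw => ?_⟩
        · by_cases hmid : w = ![i + 1, y]
          · subst hmid
            exact (hPast y p v (tr z) z (htr_agree z)).1
          · rw [(hW y p v (tr z)).1 w hmid, (hW y p v z).1 w hmid]
            have hw' : w 1 < y ∨ w 0 ≠ i + 1 := by
              rcases hw with hw | hw
              · by_cases h0 : w 0 = i + 1
                · left
                  have : w 1 ≠ y := fun h1 => hmid (by rw [ps2_eq_vec2 w, h0, h1])
                  omega
                · exact Or.inr h0
              · exact Or.inr hw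
            show (w ∈ z.1 ∧ (w 1 < y ∨ w 0 ≠ i + 1)) ↔ w ∈ z.1
            exact ⟨fun h => h.1, fun h => ⟨h, hw'⟩⟩
        · by_cases hmid1 : w = ![i, y]
          · subst hmid1
            exact (hPast y p v (tr z) z (htr_agree z)).2.1
          · by_cases hmid2 : w = ![i + 1, y]
            · subst hmid2
              exact (hPast y p v (tr z) z (htr_agree z)).2.2
            · rw [(hW y p v (tr z)).2 w hmid1 hmid2, (hW y p v z).2 w hmid1 hmid2]
              have hw' : w 1 < y ∨ (w 0 ≠ i ∧ w 0 ≠ i + 1) := by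
                rcases hw with hw | hw
                · by_cases h0 : w 0 = i
                  · left
                    have : w 1 ≠ y := fun h1 => hmid1 (by rw [ps2_eq_vec2 w, h0, h1])
                    omega
                  · by_cases h0' : w 0 = i + 1
                    · left
                      have : w 1 ≠ y := fun h1 => hmid2 (by rw [ps2_eq_vec2 w, h0', h1])
                      omega
                    · exact Or.inr ⟨h0, h0'⟩
                · exact Or.inr hw
              show (w ∈ z.2 ∧ (w 1 < y ∨ (w 0 ≠ i ∧ w 0 ≠ i + 1))) ↔ w ∈ z.2
              exact ⟨fun h => h.1, fun h => ⟨h, hw'⟩⟩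
      -- (4) the two laws agree after truncation (induction hypothesis)
      have hJY : Measurable fun xu : Obs × Rnd => (π xu.1, Y xu) := (hπ.comp measurable_fst).prodMk hY
      have hJ : Measurable fun x : Obs => (π x, x) := hπ.prodMk measurable_id
      have hlaws : (P'.map fun xu : Obs × Rnd => (π xu.1, Y xu)).map τ = (ν'.map fun x : Obs => (π x, x)).map τ := by
        refine Measure.ext fun F hF => ?_
        rw [Measure.map_apply hτm hF, Measure.map_apply hτm hF, Measure.map_apply hJY (hτm hF),
          Measure.map_apply hJ (hτm hF)]
        refine ih a (τ ⁻¹' F) (hτm hF) fun p z z' h => ?_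
        simp only [mem_preimage, hτ]
        have : tr z = tr z' := by
          refine Prod.ext (Set.ext fun w => ?_) (Set.ext fun f => ?_)
          · simp only [htr, mem_setOf_eq]
            constructor
            · rintro ⟨hz, hc⟩; exact ⟨(h.1 w (by rw [hy] at hc; exact hc)).1 hz, hc⟩
            · rintro ⟨hz, hc⟩; exact ⟨(h.1 w (by rw [hy] at hc; exact hc)).2 hz, hc⟩
          · simp only [htr, mem_setOf_eq]
            constructor
            · rintro ⟨hz, hc⟩; exact ⟨(h.2 f (by rw [hy] at hc; exact hc)).1 hz, hc⟩
            · rintro ⟨hz, hc⟩; exact ⟨(h.2 f (by rw [hy] at hc; exact hc)).2 hz, hc⟩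
        rw [this]
      -- (5) conclude
      calc P' {xu | (π xu.1, T (n + 1) a (π xu.1) xu.2 xu.1) ∈ D}
          = ∫⁻ x, ∫⁻ u, K (π x, Y (x, u)) ∂β ∂ν' := h1
        _ = ∫⁻ xu, K (π xu.1, Y xu) ∂P' :=
            (lintegral_prod (fun xu : Obs × Rnd => K (π xu.1, Y xu)) (hKm.comp hJY).aemeasurable).symm
        _ = ∫⁻ q, K q ∂(P'.map fun xu : Obs × Rnd => (π xu.1, Y xu)) := (lintegral_map hKm hJY).symm
        _ = ∫⁻ q, (K ∘ τ) q ∂(P'.map fun xu : Obs × Rnd => (π xu.1, Y xu)) := by rw [hKτ]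
        _ = ∫⁻ q, K q ∂((P'.map fun xu : Obs × Rnd => (π xu.1, Y xu)).map τ) := (lintegral_map hKm hτm).symm
        _ = ∫⁻ q, K q ∂((ν'.map fun x : Obs => (π x, x)).map τ) := by rw [hlaws]
        _ = ∫⁻ q, (K ∘ τ) q ∂(ν'.map fun x : Obs => (π x, x)) := lintegral_map hKm hτm
        _ = ∫⁻ q, K q ∂(ν'.map fun x : Obs => (π x, x)) := by rw [hKτ]
        _ = ∫⁻ x, K (π x, x) ∂ν' := lintegral_map hKm hJ
        _ = ν' {x | (π x, x) ∈ D} := h2.symm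
  refine ⟨main, fun n a D hDm hD => main n a D hDm fun p z z' h => hD p z z' fun w hw => ?_⟩
  exact ⟨h.1 w (Or.inl hw), h.2 w (Or.inl hw)⟩

end Exact

end Summit.CriticalPhenomena.CardyFormulaZ2.Theorems.IKLinearTransport.PinnedDiagramExchange
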